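import Literature.NumberTheory.Transcendental.WeakZPBasic
import HarnessLib

/-!
# Horizontal weak Zilber–Pink, step 6: the clause `(*)` by induction on the ambient subtorus,
and Bays–Kirby's Theorem 11.4 for linear slices over `ℂ`

**Main result** (`WeakZP.weakZPBound_complex`): for every Zariski closed `W ⊆ ℂ^{N ⊕ N}` there is
a finite set `𝓗` of integer matrices with `WeakZPBound ℂ N W 𝓗`
(`Literature.NumberTheory.Transcendental.WeakZPBound`, the conclusion of Bays–Kirby 2018, Thm 11.4 —
horizontal semiabelian weak Zilber–Pink with the clause `(*)` — for `S = 𝔾ₘᴺ`, `U = 𝔾ₐᴺ` and the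
family of linear slices `U_{A,k}` of `W ∩ Gᴺ`). This is the hypothesis `hZP` (at `F = ℂ`) of
`GammaField.isGenericallyStronglyGammaClosedOver_of_weakZP` (`ZilberProp115.lean`).

**Proof** (Bays–Kirby, proof of Thm 11.4: "the version without `(*)` … then apply it inductively
to the families `(W_b ∩ (c' + H))`, `H ∈ 𝓗_W`"). `WeakZP.weakZP_star`: by induction on `dim H`
we produce, for the family of slices `U_{A,k} ∩ (𝔾ₐᴺ × c·H)` (a polynomial family all of whose
members lie in cosets of `H`, `WeakZP.famV_ΦL_eq`), a finite set `𝓛_H` of rational subspaces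
(subtori) such that every `X` atypical relative to `H` lies in a coset of some `H' ∈ 𝓛_H` relative
to which it is typical (`(*)`): the basic theorem `WeakZP.weakZP_basic_rel` gives finitely many
characters `q`; `X` lies in a coset of `H_q = (H ∩ ker y^q)°`, and either `X` is typical for
`H_q` (done) or atypical, in which case the induction hypothesis for `H_q` (`dim H_q < dim H`)
applies to the very same situation. At `H = 𝔾ₘᴺ` this is Thm 11.4 for linear slices; the
translation between rational subspaces and the integer matrices of `WeakZPBound`
(`rowSat = ℤᴺ ∩ rowSpaceQ`, `rk = dim_ℚ`) is `WeakZP.weakZPBound_complex`.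

## References

* M. Bays, J. Kirby, *Pseudo-exponential maps, variants, and quasiminimality*, ANT 12 (2018),
  §2.2, Thm 11.4 (and its proof from Fact 11.3).
* J. Kirby, *The theory of the exponential differential equations of semiabelian varieties*,
  Selecta Math. 15 (2009), Thm 4.6.
-/

noncomputable section

open MvPolynomial Set

namespace Literature.NumberTheory.Transcendental.WeakZP

/-! ### Rational row spaces of integer matrices -/

section RowSpace

variable {N : ℕ}

/-- The rational row space of an integer matrix. [folklore] -/
def rowSpaceQ (M : Matrix (Fin N) (Fin N) ℤ) : Submodule ℚ (Fin N → ℚ) :=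
  Submodule.span ℚ (Set.range fun i => qv (M i))

/-- Clearing denominators in a rational combination of integer vectors. [folklore] -/
theorem exists_int_smul_mem_span_int {ι : Type*} [Fintype ι] (v : ι → Fin N → ℤ) {μ : Fin N → ℤ}
    (h : qv μ ∈ Submodule.span ℚ (Set.range fun i => qv (v i))) :
    ∃ d : ℤ, d ≠ 0 ∧ d • μ ∈ Submodule.span ℤ (Set.range v) := by
  classical
  rw [Submodule.mem_span_range_iff_exists_fun] at h
  obtain ⟨c, hc⟩ := h
  -- a common denominator
  refine ⟨∏ i, ((c i).den : ℤ), ?_, ?_⟩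
  · exact Finset.prod_ne_zero_iff.mpr fun i _ => Int.natCast_ne_zero.mpr (c i).den_nz
  · set d : ℤ := ∏ i, ((c i).den : ℤ) with hd
    -- integer coefficients `a i = d * c i`
    have ha : ∀ i, ∃ a : ℤ, (a : ℚ) = (d : ℚ) * c i := fun i => by
      refine ⟨(∏ i' ∈ Finset.univ.erase i, ((c i').den : ℤ)) * (c i).num, ?_⟩
      rw [hd, ← Finset.prod_erase_mul _ _ (Finset.mem_univ i)]
      push_cast
      rw [mul_assoc, Rat.den_mul_eq_num]
    choose a ha using ha
    have hsum : d • μ = ∑ i, a i • v i := by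
      apply qv_injective
      rw [qv_zsmul, qv_sum, ← hc, Finset.smul_sum]
      refine Finset.sum_congr rfl fun i _ => ?_
      rw [qv_zsmul, ha i, mul_smul]
    rw [hsum]
    exact Submodule.sum_mem _ fun i _ => Submodule.smul_mem _ _ (Submodule.subset_span ⟨i, rfl⟩)

/-- **The saturated row lattice is the set of integer points of the rational row space.**
[cite: BaysKirby2018ANT, §2.2] -/
theorem mem_rowSat_iff_qv_mem (M : Matrix (Fin N) (Fin N) ℤ) (μ : Fin N → ℤ) :
    μ ∈ rowSat N M ↔ qv μ ∈ rowSpaceQ M := by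
  constructor
  · rintro ⟨d, hd, hdμ⟩
    have h1 : qv (d • μ) ∈ rowSpaceQ M := by
      refine Submodule.span_induction (p := fun v _ => qv v ∈ rowSpaceQ M) ?_ ?_ ?_ ?_ hdμ
      · rintro _ ⟨i, rfl⟩; exact Submodule.subset_span ⟨i, rfl⟩
      · simp
      · intro a b _ _ ha hb; rw [qv_add]; exact Submodule.add_mem _ ha hb
      · intro n a _ ha; rw [qv_zsmul]; exact Submodule.smul_mem _ _ ha
    rw [qv_zsmul] at h1
    have := (rowSpaceQ M).smul_mem (d : ℚ)⁻¹ h1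
    rwa [inv_smul_smul₀ (Int.cast_ne_zero.mpr hd)] at this
  · intro h
    exact exists_int_smul_mem_span_int (fun i => M i) h

/-- `rowSat M = ℤᴺ ∩ rowSpaceQ M` as sets. [cite: BaysKirby2018ANT, §2.2] -/
theorem rowSat_eq_latt (M : Matrix (Fin N) (Fin N) ℤ) :
    rowSat N M = (latt (rowSpaceQ M) : Set (Fin N → ℤ)) := by
  ext μ; exact mem_rowSat_iff_qv_mem M μ

/-- `rk_ℚ M = dim_ℚ (row space)`. [folklore] -/
theorem rank_map_eq_finrank (M : Matrix (Fin N) (Fin N) ℤ) :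
    (M.map (Int.cast : ℤ → ℚ)).rank = Module.finrank ℚ (rowSpaceQ M) := by
  rw [Matrix.rank_eq_finrank_span_row]
  rfl

/-- `rk_ℚ (M_H; M_J) = dim_ℚ (row space of M_H + row space of M_J)`. [folklore] -/
theorem rank_fromRows_map_eq_finrank (MH MJ : Matrix (Fin N) (Fin N) ℤ) :
    ((Matrix.fromRows MH MJ).map (Int.cast : ℤ → ℚ)).rank =
      Module.finrank ℚ ↥(rowSpaceQ MH ⊔ rowSpaceQ MJ) := by
  rw [Matrix.rank_eq_finrank_span_row, rowSpaceQ, rowSpaceQ, ← Submodule.span_union]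
  have : Set.range ((Matrix.fromRows MH MJ).map (Int.cast : ℤ → ℚ)).row =
      (Set.range fun i => qv (MH i)) ∪ Set.range fun i => qv (MJ i) := by
    ext v
    constructor
    · rintro ⟨i | i, rfl⟩
      · exact Or.inl ⟨i, rfl⟩
      · exact Or.inr ⟨i, rfl⟩
    · rintro (⟨i, rfl⟩ | ⟨i, rfl⟩)
      · exact ⟨Sum.inl i, rfl⟩
      · exact ⟨Sum.inr i, rfl⟩
  rw [this]

/-- **Every rational subspace of `ℚᴺ` is the row space of an `N × N` integer matrix.** [folklore] -/
theorem exists_rowSpaceQ_eq (L : Submodule ℚ (Fin N → ℚ)) :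
    ∃ M : Matrix (Fin N) (Fin N) ℤ, rowSpaceQ M = L := by
  classical
  set s := Module.finrank ℚ L with hs
  have hsN : s ≤ N := finrank_le_m L
  let bs := Module.finBasis ℚ L
  have hv : ∀ i : Fin s, ∃ d : ℤ, d ≠ 0 ∧ ∃ ν : Fin N → ℤ, qv ν = (d : ℚ) • ((bs i : L) : Fin N → ℚ) :=
    fun i => exists_int_smul_eq_qv _
  choose d hd ν hν using hv
  refine ⟨fun i => if h : (i : ℕ) < s then ν ⟨i, h⟩ else 0, le_antisymm ?_ ?_⟩
  · refine Submodule.span_le.mpr ?_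
    rintro _ ⟨i, rfl⟩
    by_cases h : (i : ℕ) < s
    · simp only [h, dif_pos]
      rw [hν]
      exact L.smul_mem _ (bs ⟨i, h⟩).2
    · simp only [h, dif_neg, not_false_eq_true]
      rw [qv_zero]; exact Submodule.zero_mem _
  · -- `L` is spanned by the `bs i = d_i⁻¹ • qv (ν i)`
    intro v hv
    have hvtop : (⟨v, hv⟩ : L) ∈ Submodule.span ℚ (Set.range bs) := by rw [bs.span_eq]; trivial
    have hmap := Submodule.mem_map_of_mem (f := L.subtype) hvtop
    rw [Submodule.map_span, ← Set.range_comp] at hmap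
    refine Submodule.span_le.mpr ?_ hmap
    rintro _ ⟨i, rfl⟩
    have hi : ((Fin.castLE hsN i : Fin N) : ℕ) < s := by simp
    have hidx : (⟨((Fin.castLE hsN i : Fin N) : ℕ), hi⟩ : Fin s) = i := Fin.ext (by simp)
    have hrow : qv ((fun i : Fin N => if h : (i : ℕ) < s then ν ⟨i, h⟩ else 0) (Fin.castLE hsN i)) =
        (d i : ℚ) • ((bs i : L) : Fin N → ℚ) := by
      show qv (if h : ((Fin.castLE hsN i : Fin N) : ℕ) < s then ν ⟨_, h⟩ else 0) = _
      rw [dif_pos hi, hidx, hν]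
    have hmem : qv ((fun i : Fin N => if h : (i : ℕ) < s then ν ⟨i, h⟩ else 0) (Fin.castLE hsN i)) ∈
        rowSpaceQ (fun i : Fin N => if h : (i : ℕ) < s then ν ⟨i, h⟩ else 0) :=
      Submodule.subset_span ⟨Fin.castLE hsN i, rfl⟩
    rw [hrow] at hmem
    have := Submodule.smul_mem _ (d i : ℚ)⁻¹ hmem
    rwa [inv_smul_smul₀ (Int.cast_ne_zero.mpr (hd i))] at this

end RowSpace

/-! ### Cosets of subtori presented by rational subspaces -/

section Cosets

variable (N : ℕ)

/-- The horizontal coset `𝔾ₐᴺ × c·H_L ⊆ Gᴺ` of the subtorus `H_L` (`L ≤ ℚᴺ`) through the torus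
point `c`. [cite: BaysKirby2018ANT, §2.2 and Thm 11.4 (`U × (c + J)`)] -/
def cosetL (c : Fin N → ℂ) (L : Submodule ℚ (Fin N → ℚ)) : Set (Fin N ⊕ Fin N → ℂ) :=
  {z | z ∈ torus₂ N N ∧ ∀ ν : Fin N → ℤ, qv ν ∈ L → ∏ l, (z (Sum.inr l) / c l) ^ ν l = 1}

/-- The slice `U_{A,k} ∩ (𝔾ₐᴺ × c·H_L)` — the member of the family at level `H_L`.
[cite: BaysKirby2018ANT, Thm 11.4 (proof: "the families `(W_b ∩ (c' + H))`")] -/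
def sliceH (W : Set (Fin N ⊕ Fin N → ℂ)) (A : Matrix (Fin N) (Fin N) ℂ) (k c : Fin N → ℂ)
    (L : Submodule ℚ (Fin N → ℚ)) : Set (Fin N ⊕ Fin N → ℂ) :=
  linSlice N ℂ W A k ∩ cosetL N c L

variable {N}

/-- Membership in `cosetL`. [folklore] -/
theorem mem_cosetL_iff {c : Fin N → ℂ} {L : Submodule ℚ (Fin N → ℚ)} {z : Fin N ⊕ Fin N → ℂ} :
    z ∈ cosetL N c L ↔
      z ∈ torus₂ N N ∧ ∀ ν : Fin N → ℤ, qv ν ∈ L → ∏ l, (z (Sum.inr l) / c l) ^ ν l = 1 :=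
  Iff.rfl

/-- `torus₂ N N` is the torus locus. [folklore] -/
theorem torus₂_eq_torusLocus : torus₂ N N = torusLocus ℂ N := rfl

/-- Matrix cosets are subspace cosets: `𝔾ₐᴺ × c·(ker M)° = 𝔾ₐᴺ × c·H_{rowSpaceQ M}`. [folklore] -/
theorem cosetU_eq_cosetL (c : Fin N → ℂ) (M : Matrix (Fin N) (Fin N) ℤ) :
    cosetU N ℂ c M = cosetL N c (rowSpaceQ M) := by
  ext z
  simp only [mem_cosetU_iff, mem_cosetL_iff, ← torus₂_eq_torusLocus, mem_rowSat_iff_qv_mem]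

/-- The coset of the whole torus is the torus part. [folklore] -/
theorem cosetL_bot (c : Fin N → ℂ) : cosetL N c ⊥ = torus₂ N N := by
  ext z
  simp only [mem_cosetL_iff, Submodule.mem_bot, and_iff_left_iff_imp]
  intro _ ν hν
  have : ν = 0 := qv_injective (by rw [hν, qv_zero])
  simp [this]

/-- A subset of a coset has all its ratios killed. [folklore] -/
theorem inCoset_of_subset_cosetL {X : Set (Fin N ⊕ Fin N → ℂ)} {c : Fin N → ℂ} (hc : ∀ l, c l ≠ 0)
    {L : Submodule ℚ (Fin N → ℚ)} (h : X ⊆ cosetL N c L) : InCoset X L := by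
  intro ν hν z hz w hw
  have hz1 := (h hz).2 ν hν
  have hw1 := (h hw).2 ν hν
  rw [prod_div_zpow] at hz1 hw1 ⊢
  have hcν : (∏ l, c l ^ ν l) ≠ 0 := Finset.prod_ne_zero_iff.mpr fun l _ => zpow_ne_zero _ (hc l)
  have hwν : (∏ l, w (Sum.inr l) ^ ν l) ≠ 0 :=
    Finset.prod_ne_zero_iff.mpr fun l _ => zpow_ne_zero _ ((h hw).1 l)
  rw [div_eq_one_iff_eq hcν] at hz1 hw1
  rw [div_eq_one_iff_eq hwν, hz1, hw1]

/-- Conversely, killed ratios put `X` in the coset through any of its points. [folklore] -/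
theorem subset_cosetL_of_inCoset {X : Set (Fin N ⊕ Fin N → ℂ)} (hXT : X ⊆ torus₂ N N)
    {L : Submodule ℚ (Fin N → ℚ)} (h : InCoset X L) {x : Fin N ⊕ Fin N → ℂ} (hx : x ∈ X) :
    X ⊆ cosetL N (x ∘ Sum.inr) L :=
  fun _ hz => ⟨hXT hz, fun ν hν => h ν hν _ hz x hx⟩

/-- `cosetL` is antitone in the subspace. [folklore] -/
theorem cosetL_mono {c : Fin N → ℂ} {L L' : Submodule ℚ (Fin N → ℚ)} (hL : L ≤ L') :
    cosetL N c L' ⊆ cosetL N c L :=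
  fun _ hz => ⟨hz.1, fun ν hν => hz.2 ν (hL hν)⟩

/-- Slices lie in the torus part. [folklore] -/
theorem sliceH_subset_torus₂ {W : Set (Fin N ⊕ Fin N → ℂ)} {A : Matrix (Fin N) (Fin N) ℂ}
    {k c : Fin N → ℂ} {L : Submodule ℚ (Fin N → ℚ)} : sliceH N W A k c L ⊆ torus₂ N N :=
  fun _ hz => hz.2.1

/-- At level `⊥` (the whole torus) the slice is `U_{A,k}` itself. [folklore] -/
theorem sliceH_bot {W : Set (Fin N ⊕ Fin N → ℂ)} {A : Matrix (Fin N) (Fin N) ℂ} {k c : Fin N → ℂ} :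
    sliceH N W A k c ⊥ = linSlice N ℂ W A k := by
  rw [sliceH, cosetL_bot]
  exact inter_eq_left.mpr fun z hz => hz.2.1

end Cosets

/-! ### The polynomial family of slices `U_{A,k} ∩ (𝔾ₐᴺ × c·H)` -/

section Encoding

variable (N : ℕ)

/-- Index type of the parameters `(A, k, c, e)` (`e` intended as `c⁻¹`). [folklore] -/
abbrev ParIdx : Type := (Fin N × Fin N) ⊕ (Fin N ⊕ (Fin N ⊕ Fin N))

/-- Number of parameters. [folklore] -/
def pN : ℕ := Fintype.card (ParIdx N)

/-- Enumeration of the parameters. [folklore] -/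
def parEquiv : ParIdx N ≃ Fin (pN N) := Fintype.equivFin _

/-- The big polynomial ring `ℂ[A, k, c, e ; u, y]`. [folklore] -/
abbrev BigRing : Type := MvPolynomial (Fin (pN N) ⊕ (Fin N ⊕ Fin N)) ℂ

variable {N}

/-- Parameter variable. [folklore] -/
def pX (t : ParIdx N) : BigRing N := X (Sum.inl (parEquiv N t))

/-- The parameter vector of `(A, k, c)` (with `e = c⁻¹`). [folklore] -/
def bOf (A : Matrix (Fin N) (Fin N) ℂ) (k c : Fin N → ℂ) : Fin (pN N) → ℂ :=
  (Sum.elim (fun ij : Fin N × Fin N => A ij.1 ij.2)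
    (Sum.elim k (Sum.elim c fun l => (c l)⁻¹))) ∘ (parEquiv N).symm

/-- Decoding a parameter vector. [folklore] -/
def dec (b : Fin (pN N) → ℂ) (t : ParIdx N) : ℂ := b (parEquiv N t)

/-- Decoding `bOf`. [folklore] -/
@[simp] theorem dec_bOf (A : Matrix (Fin N) (Fin N) ℂ) (k c : Fin N → ℂ) (t : ParIdx N) :
    dec (bOf A k c) t = Sum.elim (fun ij : Fin N × Fin N => A ij.1 ij.2)
      (Sum.elim k (Sum.elim c fun l => (c l)⁻¹)) t := by
  simp [dec, bOf]

/-- `spec b` on a parameter variable. [folklore] -/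
@[simp] theorem spec_pX (b : Fin (pN N) → ℂ) (t : ParIdx N) :
    spec (σ := Fin N ⊕ Fin N) b (pX t) = C (dec b t) := by
  rw [pX, spec_X_inl]; rfl

/-- The linear equations `Σ_j A_{ij} u_j - k_i`. [cite: BaysKirby2018ANT, Prop. 11.5 (proof)] -/
def linPoly (i : Fin N) : BigRing N :=
  (∑ j, pX (Sum.inl (i, j)) * X (Sum.inr (Sum.inl j))) - pX (Sum.inr (Sum.inl i))

/-- The equations `c_l e_l - 1`. [folklore] -/
def invPoly (l : Fin N) : BigRing N :=
  pX (Sum.inr (Sum.inr (Sum.inl l))) * pX (Sum.inr (Sum.inr (Sum.inr l))) - 1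

/-- The coset binomials `∏ (y_l e_l)^{μₗ⁺} - ∏ (y_l e_l)^{μₗ⁻}`. [cite: BaysKirby2018ANT, §2.2] -/
def cosPoly (μ : Fin N → ℤ) : BigRing N :=
  (∏ l, (X (Sum.inr (Sum.inr l)) * pX (Sum.inr (Sum.inr (Sum.inr l)))) ^ (μ l).toNat) -
    ∏ l, (X (Sum.inr (Sum.inr l)) * pX (Sum.inr (Sum.inr (Sum.inr l)))) ^ (-μ l).toNat

/-- The finite set of polynomials defining the family of slices `U_{A,k} ∩ (𝔾ₐᴺ × c·H)` of
`W = Z(G)` at level `H` (`S` a finite generating set of the lattice of `H`).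
[cite: BaysKirby2018ANT, Thm 11.4 (proof)] -/
def ΦL (G : Finset (MvPolynomial (Fin N ⊕ Fin N) ℂ)) (S : Finset (Fin N → ℤ)) : Finset (BigRing N) :=
  G.image (rename Sum.inr) ∪ Finset.univ.image linPoly ∪ Finset.univ.image invPoly ∪ S.image cosPoly

variable (b : Fin (pN N) → ℂ) (w : Fin N ⊕ Fin N → ℂ)

/-- Evaluation of the `W`-equations. [folklore] -/
theorem aeval_spec_rename (g : MvPolynomial (Fin N ⊕ Fin N) ℂ) :
    aeval w (spec b (rename Sum.inr g)) = aeval w g := by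
  rw [spec, aeval_rename]
  have : (aeval (Sum.elim (fun l => C (b l)) X ∘ Sum.inr) : MvPolynomial (Fin N ⊕ Fin N) ℂ →ₐ[ℂ] _) =
      AlgHom.id ℂ _ := by
    ext i
    simp
  rw [this, AlgHom.id_apply]

/-- Evaluation of the linear equations. [folklore] -/
theorem aeval_spec_linPoly (i : Fin N) :
    aeval w (spec b (linPoly i)) =
      (Matrix.of fun i j => dec b (Sum.inl (i, j))).mulVec (w ∘ Sum.inl) i -
        dec b (Sum.inr (Sum.inl i)) := by
  simp [linPoly, Matrix.mulVec, dotProduct, map_sum, map_mul, map_sub, spec_X_inr]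

/-- Evaluation of the `c e = 1` equations. [folklore] -/
theorem aeval_spec_invPoly (l : Fin N) :
    aeval w (spec b (invPoly l)) =
      dec b (Sum.inr (Sum.inr (Sum.inl l))) * dec b (Sum.inr (Sum.inr (Sum.inr l))) - 1 := by
  simp [invPoly, map_mul, map_sub]

/-- Evaluation of the coset binomials. [folklore] -/
theorem aeval_spec_cosPoly (μ : Fin N → ℤ) :
    aeval w (spec b (cosPoly μ)) =
      (∏ l, (w (Sum.inr l) * dec b (Sum.inr (Sum.inr (Sum.inr l)))) ^ (μ l).toNat) -
        ∏ l, (w (Sum.inr l) * dec b (Sum.inr (Sum.inr (Sum.inr l)))) ^ (-μ l).toNat := by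
  simp [cosPoly, map_mul, map_sub, map_prod, map_pow, spec_X_inr]

/-- For units `t_l`, `∏ t_l^{μₗ⁺} = ∏ t_l^{μₗ⁻}` iff `∏ t_l^{μₗ} = 1`. [folklore] -/
theorem prod_pow_toNat_eq_iff {t : Fin N → ℂ} (ht : ∀ l, t l ≠ 0) (μ : Fin N → ℤ) :
    (∏ l, t l ^ (μ l).toNat) = ∏ l, t l ^ (-μ l).toNat ↔ ∏ l, t l ^ μ l = 1 := by
  have hne : (∏ l, t l ^ (-μ l).toNat) ≠ 0 :=
    Finset.prod_ne_zero_iff.mpr fun l _ => pow_ne_zero _ (ht l)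
  have hprod : ∏ l, t l ^ μ l = (∏ l, t l ^ (μ l).toNat) / ∏ l, t l ^ (-μ l).toNat := by
    rw [← Finset.prod_div_distrib]
    refine Finset.prod_congr rfl fun l _ => ?_
    rw [← zpow_natCast, ← zpow_natCast, ← zpow_sub₀ (ht l), Int.toNat_sub_toNat_neg]
  rw [hprod, div_eq_one_iff_eq hne]

/-- The matrix `A` encoded in `b`. [folklore] -/
def decA (b : Fin (pN N) → ℂ) : Matrix (Fin N) (Fin N) ℂ := Matrix.of fun i j => dec b (Sum.inl (i, j))

/-- The vector `k` encoded in `b`. [folklore] -/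
def deck (b : Fin (pN N) → ℂ) : Fin N → ℂ := fun i => dec b (Sum.inr (Sum.inl i))

/-- The torus point `c` encoded in `b`. [folklore] -/
def decc (b : Fin (pN N) → ℂ) : Fin N → ℂ := fun l => dec b (Sum.inr (Sum.inr (Sum.inl l)))

/-- The vector `e` (intended inverse of `c`) encoded in `b`. [folklore] -/
def dece (b : Fin (pN N) → ℂ) : Fin N → ℂ := fun l => dec b (Sum.inr (Sum.inr (Sum.inr l)))

/-- Decoding `A` from `bOf`. [folklore] -/
@[simp] theorem decA_bOf (A : Matrix (Fin N) (Fin N) ℂ) (k c : Fin N → ℂ) : decA (bOf A k c) = A := by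
  ext i j; simp [decA]

/-- Decoding `k` from `bOf`. [folklore] -/
@[simp] theorem deck_bOf (A : Matrix (Fin N) (Fin N) ℂ) (k c : Fin N → ℂ) : deck (bOf A k c) = k := by
  funext i; simp [deck]

/-- Decoding `c` from `bOf`. [folklore] -/
@[simp] theorem decc_bOf (A : Matrix (Fin N) (Fin N) ℂ) (k c : Fin N → ℂ) : decc (bOf A k c) = c := by
  funext l; simp [decc]

/-- Decoding `e = c⁻¹` from `bOf`. [folklore] -/
@[simp] theorem dece_bOf (A : Matrix (Fin N) (Fin N) ℂ) (k c : Fin N → ℂ) :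
    dece (bOf A k c) = fun l => (c l)⁻¹ := by
  funext l; simp [dece]

/-- **Members of the family.** `w ∈ V_b` iff `w` is a torus point of `Z(G)` on the linear slice
`A_b u = k_b`, the parameters satisfy `c_b e_b = 1`, and `(w e_b)^μ = 1` for the generators `μ ∈ S`.
[folklore] -/
theorem mem_famV_ΦL_iff (G : Finset (MvPolynomial (Fin N ⊕ Fin N) ℂ)) (S : Finset (Fin N → ℤ)) :
    w ∈ famV (ΦL G S) b ↔
      w ∈ torus₂ N N ∧ (∀ g ∈ G, aeval w g = 0) ∧ (decA b).mulVec (w ∘ Sum.inl) = deck b ∧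
      (∀ l, decc b l * dece b l = 1) ∧ ∀ μ ∈ S, ∏ l, (w (Sum.inr l) * dece b l) ^ μ l = 1 := by
  classical
  simp only [decA, decc, dece]
  rw [mem_famV_iff]
  refine and_congr_right fun hwT => ?_
  simp only [ΦL, Finset.mem_union, Finset.mem_image, Finset.mem_univ, true_and, or_assoc]
  constructor
  · intro h
    have hG : ∀ g ∈ G, aeval w g = 0 := fun g hg => by
      rw [← aeval_spec_rename b w g]; exact h _ (Or.inl ⟨g, hg, rfl⟩)
    have hlin : ∀ i, aeval w (spec b (linPoly i)) = 0 := fun i => h _ (Or.inr (Or.inl ⟨i, rfl⟩))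
    have hinv : ∀ l, aeval w (spec b (invPoly l)) = 0 := fun l =>
      h _ (Or.inr (Or.inr (Or.inl ⟨l, rfl⟩)))
    have hcos : ∀ μ ∈ S, aeval w (spec b (cosPoly μ)) = 0 := fun μ hμ =>
      h _ (Or.inr (Or.inr (Or.inr ⟨μ, hμ, rfl⟩)))
    simp only [aeval_spec_invPoly, sub_eq_zero] at hinv
    refine ⟨hG, ?_, hinv, fun μ hμ => ?_⟩
    · funext i
      have := hlin i
      rwa [aeval_spec_linPoly, sub_eq_zero] at this
    · have he : ∀ l, w (Sum.inr l) * dec b (Sum.inr (Sum.inr (Sum.inr l))) ≠ 0 := fun l =>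
        mul_ne_zero (hwT l) (right_ne_zero_of_mul_eq_one (hinv l))
      have := hcos μ hμ
      rw [aeval_spec_cosPoly, sub_eq_zero] at this
      exact (prod_pow_toNat_eq_iff he μ).1 this
  · rintro ⟨hG, hlin, hinv, hcos⟩ φ hφ
    rcases hφ with ⟨g, hg, rfl⟩ | ⟨i, rfl⟩ | ⟨l, rfl⟩ | ⟨μ, hμ, rfl⟩
    · rw [aeval_spec_rename]; exact hG g hg
    · rw [aeval_spec_linPoly, hlin]; exact sub_self _
    · rw [aeval_spec_invPoly, hinv l, sub_self]
    · have he : ∀ l, w (Sum.inr l) * dec b (Sum.inr (Sum.inr (Sum.inr l))) ≠ 0 := fun l =>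
        mul_ne_zero (hwT l) (right_ne_zero_of_mul_eq_one (hinv l))
      rw [aeval_spec_cosPoly, sub_eq_zero]
      exact (prod_pow_toNat_eq_iff he μ).2 (hcos μ hμ)

end Encoding

/-! ### The family at level `H_L`: members are the slices `U_{A,k} ∩ (𝔾ₐᴺ × c·H_L)` -/

section Level

variable {N : ℕ}

/-- A Zariski closed set is cut out by finitely many polynomials. [folklore] -/
theorem exists_finset_eq_of_isZariskiClosed {W : Set (Fin N ⊕ Fin N → ℂ)} (hW : IsZariskiClosed ℂ W) :
    ∃ G : Finset (MvPolynomial (Fin N ⊕ Fin N) ℂ), W = {z | ∀ g ∈ G, aeval z g = 0} := by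
  classical
  obtain ⟨I, rfl⟩ := hW
  obtain ⟨G, hG⟩ := (IsNoetherian.noetherian I : I.FG)
  refine ⟨G, ?_⟩
  ext z
  rw [mem_zeroLocus_iff, Set.mem_setOf_eq]
  constructor
  · intro h g hg
    exact h g (hG ▸ Ideal.subset_span hg)
  · intro h f hf
    rw [← hG] at hf
    refine Submodule.span_induction (p := fun f _ => aeval z f = 0) (fun g hg => h g hg) (map_zero _)
      (fun f g _ _ hf hg => by rw [map_add, hf, hg, add_zero])
      (fun a f _ hf => by rw [smul_eq_mul, map_mul, hf, mul_zero]) hf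

/-- The lattice `ℤᴺ ∩ L` is generated by a finite set. [folklore] -/
theorem exists_finset_closure_eq_latt (L : Submodule ℚ (Fin N → ℚ)) :
    ∃ S : Finset (Fin N → ℤ), AddSubgroup.closure (S : Set (Fin N → ℤ)) = latt L := by
  classical
  obtain ⟨U, -, I, -, -, -, hgen⟩ := WeakCIT.exists_unimodular (latt L) (nsmulSaturated_latt L)
  refine ⟨I.image fun i => U i, ?_⟩
  rw [hgen, Finset.coe_image]

/-- Characters trivial on generators are trivial on the generated subgroup. [folklore] -/
theorem prod_div_zpow_eq_one_of_mem_closure {z c : Fin N → ℂ} (hz : ∀ l, z l ≠ 0) (hc : ∀ l, c l ≠ 0)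
    {S : Set (Fin N → ℤ)} (hS : ∀ μ ∈ S, ∏ l, (z l / c l) ^ μ l = 1) {ν : Fin N → ℤ}
    (hν : ν ∈ AddSubgroup.closure S) : ∏ l, (z l / c l) ^ ν l = 1 := by
  induction hν using AddSubgroup.closure_induction with
  | mem μ hμ => exact hS μ hμ
  | zero => simp
  | add a b _ _ ha hb =>
    simp only [Pi.add_apply, zpow_add₀ (div_ne_zero (hz _) (hc _)), Finset.prod_mul_distrib, ha, hb,
      mul_one]
  | neg a _ ha => simp only [Pi.neg_apply, zpow_neg, Finset.prod_inv_distrib, ha, inv_one]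

variable {W : Set (Fin N ⊕ Fin N → ℂ)} {G : Finset (MvPolynomial (Fin N ⊕ Fin N) ℂ)}
  (hG : W = {z | ∀ g ∈ G, aeval z g = 0}) {L : Submodule ℚ (Fin N → ℚ)} {S : Finset (Fin N → ℤ)}
  (hS : AddSubgroup.closure (S : Set (Fin N → ℤ)) = latt L)

include hG hS

/-- **The members of the family at level `H_L` are the slices** `U_{A_b,k_b} ∩ (𝔾ₐᴺ × c_b·H_L)`
when `c_b e_b = 1`. [cite: BaysKirby2018ANT, Thm 11.4 (proof)] -/
theorem famV_ΦL_eq_sliceH {b : Fin (pN N) → ℂ} (hce : ∀ l, decc b l * dece b l = 1) :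
    famV (ΦL G S) b = sliceH N W (decA b) (deck b) (decc b) L := by
  have hc : ∀ l, decc b l ≠ 0 := fun l => left_ne_zero_of_mul_eq_one (hce l)
  have he : ∀ l, dece b l = (decc b l)⁻¹ := fun l => (eq_inv_of_mul_eq_one_right (hce l))
  ext w
  rw [mem_famV_ΦL_iff, sliceH, mem_inter_iff, mem_linSlice_iff, mem_cosetL_iff, hG, mem_setOf_eq,
    ← torus₂_eq_torusLocus]
  constructor
  · rintro ⟨hwT, hwG, hlin, -, hcos⟩
    refine ⟨⟨hwG, hwT, hlin⟩, hwT, fun ν hν => ?_⟩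
    have hν' : ν ∈ AddSubgroup.closure (S : Set (Fin N → ℤ)) := by rw [hS]; exact hν
    refine prod_div_zpow_eq_one_of_mem_closure (fun l => hwT l) hc (fun μ hμ => ?_) hν'
    have := hcos μ hμ
    simpa only [he, div_eq_mul_inv] using this
  · rintro ⟨⟨hwG, hwT, hlin⟩, -, hcos⟩
    refine ⟨hwT, hwG, hlin, hce, fun μ hμ => ?_⟩
    have hμ' : qv μ ∈ L := by
      have : μ ∈ latt L := by rw [← hS]; exact AddSubgroup.subset_closure hμ
      exact this
    have := hcos μ hμ'
    simpa only [he, div_eq_mul_inv] using this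

omit hG hS in
/-- When `c_b e_b ≠ 1` the member is empty. [folklore] -/
theorem famV_ΦL_eq_empty {b : Fin (pN N) → ℂ} (hce : ¬ ∀ l, decc b l * dece b l = 1) :
    famV (ΦL G S) b = ∅ := by
  ext w
  simp only [mem_empty_iff_false, iff_false]
  intro hw
  exact hce ((mem_famV_ΦL_iff b w G S).1 hw).2.2.2.1

/-- The member at the parameter `bOf A k c` (`c` a torus point) is the slice
`U_{A,k} ∩ (𝔾ₐᴺ × c·H_L)`. [cite: BaysKirby2018ANT, Thm 11.4 (proof)] -/
theorem famV_ΦL_bOf (A : Matrix (Fin N) (Fin N) ℂ) (k : Fin N → ℂ) {c : Fin N → ℂ} (hc : ∀ l, c l ≠ 0) :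
    famV (ΦL G S) (bOf A k c) = sliceH N W A k c L := by
  rw [famV_ΦL_eq_sliceH hG hS (b := bOf A k c) (fun l => by simp [mul_inv_cancel₀ (hc l)])]
  simp

/-- **All members of the family lie in cosets of `H_L`.** [cite: BaysKirby2018ANT, Thm 11.4 (proof)] -/
theorem inCoset_famV_ΦL (b : Fin (pN N) → ℂ) : InCoset (famV (ΦL G S) b) L := by
  by_cases hce : ∀ l, decc b l * dece b l = 1
  · rw [famV_ΦL_eq_sliceH hG hS hce]
    exact inCoset_of_subset_cosetL (fun l => left_ne_zero_of_mul_eq_one (hce l)) inter_subset_right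
  · rw [famV_ΦL_eq_empty hce]
    intro ν _ z hz; exact absurd hz (notMem_empty z)

end Level

/-! ### The clause `(*)` by induction on `dim H` -/

section Star

variable {N : ℕ}

/-- `dim (L + ℚq) = dim L + 1` for `q ∉ L` — this is Mathlib's `Submodule.finrank_sup_span_singleton`;
kept as a deprecated alias (librarian sweep g24, pass 2). [folklore] -/
@[deprecated Submodule.finrank_sup_span_singleton (since := "2026-08-16")]
alias finrank_sup_span_singleton := Submodule.finrank_sup_span_singleton

/-- **Weak Zilber–Pink with `(*)`, relative to `H_{L_H}`, for the slices of `W`** (Bays–Kirby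
2018, proof of Thm 11.4: the basic version applied inductively to the families
`(W_b ∩ (c' + H))_{H ∈ 𝓗_W}`). By induction on `n ≥ dim H = N - dim L_H`: there is a finite set `𝓛`
of rational subspaces such that for every slice `U_{A,k}`, every `x ∈ X ⊆ U_{A,k} ∩ (𝔾ₐᴺ × x₂·H)`
with `X` irreducible (`I(X)` prime) lying in a coset of `J = H_{L_J}` and atypical relative to `H`,
some `L' ∈ 𝓛` has `X ⊆ 𝔾ₐᴺ × x₂·H_{L'}` and `X` typical relative to `H_{L'}`:
`dim X + dim_ℚ (L' + L_J) ≤ dim (U_{A,k} ∩ (𝔾ₐᴺ × x₂·H_{L'})) + dim_ℚ L'`.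
[cite: BaysKirby2018ANT, Thm 11.4 (proof)] -/
theorem weakZP_star {W : Set (Fin N ⊕ Fin N → ℂ)} (hW : IsZariskiClosed ℂ W) (n : ℕ) :
    ∀ LH : Submodule ℚ (Fin N → ℚ), N - Module.finrank ℚ LH ≤ n →
    ∃ 𝓛 : Finset (Submodule ℚ (Fin N → ℚ)),
      ∀ (A : Matrix (Fin N) (Fin N) ℂ) (k : Fin N → ℂ) (x : Fin N ⊕ Fin N → ℂ)
        (LJ : Submodule ℚ (Fin N → ℚ)) (X : Set (Fin N ⊕ Fin N → ℂ)),
        X ⊆ linSlice N ℂ W A k → x ∈ X → X ⊆ cosetL N (x ∘ Sum.inr) LH → InCoset X LJ →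
        (vanishingIdeal ℂ X).IsPrime →
        zariskiDim ℂ (sliceH N W A k (x ∘ Sum.inr) LH) +
            ((N - Module.finrank ℚ ↥(LH ⊔ LJ) : ℕ) : WithBot ℕ∞) <
          zariskiDim ℂ X + ((N - Module.finrank ℚ LH : ℕ) : WithBot ℕ∞) →
        ∃ L' ∈ 𝓛, X ⊆ cosetL N (x ∘ Sum.inr) L' ∧
          zariskiDim ℂ X + (Module.finrank ℚ ↥(L' ⊔ LJ) : WithBot ℕ∞) ≤
            zariskiDim ℂ (sliceH N W A k (x ∘ Sum.inr) L') + (Module.finrank ℚ L' : WithBot ℕ∞) := by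
  classical
  obtain ⟨G, hG⟩ := exists_finset_eq_of_isZariskiClosed hW
  induction n with
  | zero =>
    intro LH hLH
    refine ⟨∅, ?_⟩
    intro A k x LJ X hXU hx hXH hXJ hprime hlt
    exfalso
    have hρ : Module.finrank ℚ ↥(LH ⊔ LJ) ≤ N := finrank_le_m _
    have hh : Module.finrank ℚ LH ≤ Module.finrank ℚ ↥(LH ⊔ LJ) := Submodule.finrank_mono le_sup_left
    have h1 : N - Module.finrank ℚ ↥(LH ⊔ LJ) = 0 := by omega
    have h0 : N - Module.finrank ℚ LH = 0 := by omega
    rw [h1, h0, Nat.cast_zero, add_zero, add_zero] at hlt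
    have hsub : X ⊆ sliceH N W A k (x ∘ Sum.inr) LH := fun z hz => ⟨hXU hz, hXH hz⟩
    exact not_lt_of_ge (zariskiDim_mono hsub) hlt
  | succ n ih =>
    intro LH hLH
    by_cases hle : N - Module.finrank ℚ LH ≤ n
    · exact ih LH hle
    -- generators of the lattice of `H` and the basic theorem for the family at level `H`
    obtain ⟨S, hS⟩ := exists_finset_closure_eq_latt LH
    obtain ⟨𝓠, h𝓠, hbasic⟩ := weakZP_basic_rel (ΦL G S) LH (inCoset_famV_ΦL hG hS)
    -- the induction hypothesis at the levels `H_q = (H ∩ ker y^q)°`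
    have hfr : ∀ q ∈ 𝓠, Module.finrank ℚ ↥(LH ⊔ Submodule.span ℚ {qv q}) = Module.finrank ℚ LH + 1 :=
      fun q hq => Submodule.finrank_sup_span_singleton (h𝓠 q hq)
    have hIH : ∀ q ∈ 𝓠, ∃ 𝓛q : Finset (Submodule ℚ (Fin N → ℚ)),
        ∀ (A : Matrix (Fin N) (Fin N) ℂ) (k : Fin N → ℂ) (x : Fin N ⊕ Fin N → ℂ)
          (LJ : Submodule ℚ (Fin N → ℚ)) (X : Set (Fin N ⊕ Fin N → ℂ)),
          X ⊆ linSlice N ℂ W A k → x ∈ X →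
          X ⊆ cosetL N (x ∘ Sum.inr) (LH ⊔ Submodule.span ℚ {qv q}) → InCoset X LJ →
          (vanishingIdeal ℂ X).IsPrime →
          zariskiDim ℂ (sliceH N W A k (x ∘ Sum.inr) (LH ⊔ Submodule.span ℚ {qv q})) +
              ((N - Module.finrank ℚ ↥((LH ⊔ Submodule.span ℚ {qv q}) ⊔ LJ) : ℕ) : WithBot ℕ∞) <
            zariskiDim ℂ X +
              ((N - Module.finrank ℚ ↥(LH ⊔ Submodule.span ℚ {qv q}) : ℕ) : WithBot ℕ∞) →
          ∃ L' ∈ 𝓛q, X ⊆ cosetL N (x ∘ Sum.inr) L' ∧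
            zariskiDim ℂ X + (Module.finrank ℚ ↥(L' ⊔ LJ) : WithBot ℕ∞) ≤
              zariskiDim ℂ (sliceH N W A k (x ∘ Sum.inr) L') +
                (Module.finrank ℚ L' : WithBot ℕ∞) :=
      fun q hq => ih _ (by rw [hfr q hq]; omega)
    choose! 𝓛q h𝓛q using hIH
    refine ⟨𝓠.image (fun q => LH ⊔ Submodule.span ℚ {qv q}) ∪ 𝓠.biUnion 𝓛q, ?_⟩
    intro A k x LJ X hXU hx hXH hXJ hprime hlt
    have hXT : X ⊆ torus₂ N N := fun z hz => (hXU hz).2.1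
    have hc : ∀ l, (x ∘ Sum.inr) l ≠ 0 := fun l => hXT hx l
    have hfam : famV (ΦL G S) (bOf A k (x ∘ Sum.inr)) = sliceH N W A k (x ∘ Sum.inr) LH :=
      famV_ΦL_bOf hG hS A k hc
    have hXV : X ⊆ famV (ΦL G S) (bOf A k (x ∘ Sum.inr)) := by
      rw [hfam]; exact fun z hz => ⟨hXU hz, hXH hz⟩
    obtain ⟨q, hq, hXq⟩ :=
      hbasic (bOf A k (x ∘ Sum.inr)) LJ X hXV hXJ ⟨x, hx⟩ hprime (by rw [hfam]; exact hlt)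
    have hXHq : X ⊆ cosetL N (x ∘ Sum.inr) (LH ⊔ Submodule.span ℚ {qv q}) :=
      subset_cosetL_of_inCoset hXT hXq hx
    -- natural number dimensions
    obtain ⟨dX, hdX, -⟩ := exists_nat_zariskiDim_eq (ι := Fin N ⊕ Fin N) ⟨x, hx⟩
    have hxS : x ∈ sliceH N W A k (x ∘ Sum.inr) (LH ⊔ Submodule.span ℚ {qv q}) := ⟨hXU hx, hXHq hx⟩
    obtain ⟨dS, hdS, -⟩ := exists_nat_zariskiDim_eq (ι := Fin N ⊕ Fin N) ⟨x, hxS⟩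
    have hρN : Module.finrank ℚ ↥((LH ⊔ Submodule.span ℚ {qv q}) ⊔ LJ) ≤ N := finrank_le_m _
    have hhρ : Module.finrank ℚ ↥(LH ⊔ Submodule.span ℚ {qv q}) ≤
        Module.finrank ℚ ↥((LH ⊔ Submodule.span ℚ {qv q}) ⊔ LJ) :=
      Submodule.finrank_mono le_sup_left
    -- typical relative to `H_q`, or not
    by_cases htyp : dX + Module.finrank ℚ ↥((LH ⊔ Submodule.span ℚ {qv q}) ⊔ LJ) ≤
        dS + Module.finrank ℚ ↥(LH ⊔ Submodule.span ℚ {qv q})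
    · refine ⟨LH ⊔ Submodule.span ℚ {qv q}, Finset.mem_union_left _ (Finset.mem_image.2 ⟨q, hq, rfl⟩),
        hXHq, ?_⟩
      rw [hdX, hdS]
      exact_mod_cast htyp
    · -- atypical relative to `H_q`: the induction hypothesis applies to the same situation
      have hlt' : zariskiDim ℂ (sliceH N W A k (x ∘ Sum.inr) (LH ⊔ Submodule.span ℚ {qv q})) +
          ((N - Module.finrank ℚ ↥((LH ⊔ Submodule.span ℚ {qv q}) ⊔ LJ) : ℕ) : WithBot ℕ∞) <
          zariskiDim ℂ X +
            ((N - Module.finrank ℚ ↥(LH ⊔ Submodule.span ℚ {qv q}) : ℕ) : WithBot ℕ∞) := by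
        rw [hdX, hdS]
        have : dS + (N - Module.finrank ℚ ↥((LH ⊔ Submodule.span ℚ {qv q}) ⊔ LJ)) <
            dX + (N - Module.finrank ℚ ↥(LH ⊔ Submodule.span ℚ {qv q})) := by omega
        exact_mod_cast this
      obtain ⟨L', hL', hXL', hle'⟩ := h𝓛q q hq A k x LJ X hXU hx hXHq hXJ hprime hlt'
      exact ⟨L', Finset.mem_union_right _ (Finset.mem_biUnion.2 ⟨q, hq, hL'⟩), hXL', hle'⟩

/-- **Bays–Kirby 2018, Theorem 11.4 (horizontal semiabelian weak Zilber–Pink with `(*)`) for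
`S = 𝔾ₘᴺ`, `U = 𝔾ₐᴺ` and the family of linear slices of a Zariski closed `W ⊆ ℂ^{N ⊕ N}`**: there
is a finite set `𝓗` of integer matrices with `WeakZPBound ℂ N W 𝓗`. This is the hypothesis `hZP`
of `GammaField.isGenericallyStronglyGammaClosedOver_of_weakZP` over `ℂ`.
[cite: BaysKirby2018ANT, Thm 11.4] -/
theorem weakZPBound_complex {W : Set (Fin N ⊕ Fin N → ℂ)} (hW : IsZariskiClosed ℂ W) :
    ∃ 𝓗 : Finset (Matrix (Fin N) (Fin N) ℤ), WeakZPBound ℂ N W 𝓗 := by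
  classical
  obtain ⟨𝓛, h𝓛⟩ := weakZP_star hW N ⊥ (by simp)
  have hM : ∀ L : Submodule ℚ (Fin N → ℚ), ∃ M : Matrix (Fin N) (Fin N) ℤ, rowSpaceQ M = L :=
    exists_rowSpaceQ_eq
  choose M hM using hM
  refine ⟨𝓛.image M, ?_⟩
  intro A k MJ c X hc hcomp hlt x hx
  obtain ⟨⟨Xc, hXc, hXeq, hXne⟩, hXS, -⟩ := hcomp
  have hprime : (vanishingIdeal ℂ X).IsPrime := by
    rw [IsIrreducibleInG.vanishingIdeal_eq hXc hXeq hXne]; exact hXc.2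
  have hXU : X ⊆ linSlice N ℂ W A k := fun z hz => (hXS hz).1
  have hXT : X ⊆ torus₂ N N := fun z hz => (hXU hz).2.1
  have hXJ : InCoset X (rowSpaceQ MJ) :=
    inCoset_of_subset_cosetL hc (by rw [← cosetU_eq_cosetL]; exact fun z hz => (hXS hz).2)
  have hXH : X ⊆ cosetL N (x ∘ Sum.inr) ⊥ := by rw [cosetL_bot]; exact hXT
  have hfr0 : Module.finrank ℚ ↥((⊥ : Submodule ℚ (Fin N → ℚ)) ⊔ rowSpaceQ MJ) =
      (MJ.map (Int.cast : ℤ → ℚ)).rank := by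
    rw [bot_sup_eq, rank_map_eq_finrank]
  have hlt' : zariskiDim ℂ (sliceH N W A k (x ∘ Sum.inr) ⊥) +
        ((N - Module.finrank ℚ ↥((⊥ : Submodule ℚ (Fin N → ℚ)) ⊔ rowSpaceQ MJ) : ℕ) : WithBot ℕ∞) <
      zariskiDim ℂ X + ((N - Module.finrank ℚ (⊥ : Submodule ℚ (Fin N → ℚ)) : ℕ) : WithBot ℕ∞) := by
    rw [sliceH_bot, hfr0, finrank_bot, Nat.sub_zero]
    exact hlt
  obtain ⟨L', hL', hXL', hle⟩ := h𝓛 A k x (rowSpaceQ MJ) X hXU hx hXH hXJ hprime hlt'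
  refine ⟨M L', Finset.mem_image_of_mem M hL', ?_, ?_⟩
  · rw [cosetU_eq_cosetL, hM]; exact hXL'
  · have h1 : linSlice N ℂ W A k ∩ cosetU N ℂ (x ∘ Sum.inr) (M L') = sliceH N W A k (x ∘ Sum.inr) L' := by
      rw [sliceH, cosetU_eq_cosetL, hM]
    rw [rank_fromRows_map_eq_finrank, rank_map_eq_finrank, hM, h1]
    exact hle

end Star

end Literature.NumberTheory.Transcendental.WeakZP
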